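import Summits.Parity.GeneralizedHardyLittlewood.Theses.LeeYangFibres
import Literature.NumberTheory.Sieve.BombieriAsymptoticSieveVectorProofs
import Literature.NumberTheory.Sieve.LevelOfDistribution

/-!
# Skeleton line `signed-switching-moebius-residual` for crux `CellParityLaw` (stmt-Parity-14109) — gen 2

Route `LeeYangFibres`, crux r3 `CellParityLaw`: the joint rough `Ω`-cell counts `C_j`, `j ∈ [1,u]^t`, of a
non-degenerate `d = 1` system of `t` affine forms equal `W(σ(j)) · archFactor · singularProduct · ∏ A_{j_i}(N)/N`
up to `ε N / log^t N`, `W` a Walsh polynomial in the parity vector with `θ_∅ = 1`, `|θ_S| ≤ 2`.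

## The line (idea card `signed-switching-moebius-residual`, r1 ideator 2; triage r1 3 × pass; gen-1 skeleton
2026-08-16T00:36Z; THIS FILE = gen-2 revision, same lever, three corrections recorded below)

KEEP THE SIGN OF THE REMAINDER.  For ONE coordinate `φ` of a PAIR `(φ, ψ)`, conditioned on the exact rough
cell `jc` of the OTHER form `ψ`, run the Friedlander–Iwaniec dissection of `∑_{n : ψ(n) ∈ Cell_jc} Λ_(a∷k')(φ(n))`
(tree `BombieriSieve.sum_eq_sigma0V_add_sigma1V_add_sigma2V`: `Λ_(a∷k')(m) = ∑_{de=m} 𝔏_(k')(d)(log e)^a`,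
`𝔏_(k') = μ ∗ Λ_(k')`, FriedlanderIwaniecPisa1978 p. 735; front exponent `a ≥ 2` as in the tree's `vector_cons`)
with pre-sieve `z = N^η` and the divisor truncated at the Bombieri–Vinogradov level `y = N^{1/2-δ}`:
* `Σ₀` (values of `φ` with a prime factor `< z`): `≪ η ·` main, upper-bound sieve — PARITY-SENSITIVE, so `η → 0`;
* `Σ₁` (`d < y`): fundamental lemma (`s = δ/2η`) + Bombieri–Vinogradov for rough `Ω`-cells of ONE form
  (`stub_bvRoughCells`, PROVABLE: Siegel–Walfisz + bilinear large sieve);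
* `Σ₂` (`d ≥ y`, codivisor `e = φ(n)/d` automatically `z`-rough, so `e = 1` with weight `(log 1)^a = 0`, or
  `z ≤ e ≤ (L+1)N^{1/2+δ}`): KEPT SIGNED.  For vector weights `Σ₂V` carries a main term
  (`∑_{q ≤ Q} 𝔏_(k')(q) ≍ Q (log Q)^{|k'|-2}`, e.g. `∑_{q≤Q}(μ∗Λ₂)(q) ∼ 2Q`; gen-1's finding), so the honest
  beyond-BV input is the SIGNED COMPARISON `Σ₂V(conditioned) − ρ · Σ₂V(unconditioned)`,
  `ρ = 𝔖(φ,ψ)(A_jc(N)/N)/𝔖(φ)` — the balanced cell indicator `1_{Cell_jc}(ψ(n)) − ρ` against Möbius-type signs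
  `𝔏_(k')(d)` along the DILATED copies `φ/e`, summed WITH THE SIGN over the dilations `e` (`stub_signedResidual`,
  the ATOM; Harman, *Prime-Detecting Sieves* §14.2 (ii), localised, balanced, signed).
* `stub_vectorLawTwo`: BV + atom ⟹ the `t = 2` vector `Λ`-laws in RELATIVE form (`VectorLambdaLawTwoRel`,
  the card's Transfer `C⁺`), by the dissection run twice and compared; `stub_completenessTwo`: Bombieri
  completeness + Walsh assembly ⟹ `CellParityLawRelAt 2`; `stub_absoluteCellsTwo`: the declared residual
  relative ⇒ absolute at `t = 2`; `stub_singleFormCells`: `t = 1`; `stub_higherRung`: the honest open `t ≥ 3` rung.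

## Gen-2 corrections (why this file differs from gen-1's)
(A) PARITY-BLINDNESS OF THE ATOM NEEDS THE ACCURACY COUPLED TO THE PRE-SIEVE.  Gen-1 typed the atom
`∀η ∀ε ∃N₀ : |Σ₂V(c) − ρΣ₂V(u)| ≤ ε·(absolute scale)` and argued "all parity mass sits at tiny dilations
`e < E₀`, killed by `(log e)^a`" — the UNSIFTED picture.  Under the pre-sieve the dilations are `z`-rough (the
`E₀` cut is vacuous) and the ghost's parity mass sits in `Σ₀` and, mirrored, in `Σ₂` over `e ∈ [z, z^{O(1)}]`:
in the pair-ghost world `w = 1 + λ(φ)λ(ψ)` — and identically in the exceptional-character world for the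
RESONANT pair `(n, n + q₁)`, where that ghost is realised (ideator-3 note `UpperBoundContent-ideator3.md` §3–4) —
`Σ₂V(c) − ρΣ₂V(u) ≈ (−1)^{jc} ρ x V(z)(log z)^a ∫₁^s v^a ℓ(v) dv ≍ η^{a−1} · main`, `ℓ` the alternating
Buchstab function (`1 + ∫₁^∞ ℓ e^{-λv} dv = e^{-E₁(λ)}`, so `∫vℓ = −e^γ`, `∫v²ℓ = −2e^γ ≠ 0`; planner's numeric
check `compute/alt_buchstab_moments.py`).  So a fixed-`η` `o(main)` atom is parity- and Siegel-SENSITIVE.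
The repair: `∀ε ∃η₀ ∀η ≤ η₀ ∃N₀` (below).  With it the atom is IMPLIED BACK by `VectorLambdaLawTwoRel` + BV +
the `t = 1` facts up to `O(ε + η + e^{-δ/2η})` (dissection identity: `Σ₂ = S − Σ₀ − Σ₁`), hence consistent with
every ghost/Siegel world in which the parity-even laws hold — genuinely parity-blind, no overshoot — and it is
literally what `stub_vectorLawTwo` consumes (`η → 0` is taken there anyway).  This also answers ideator-3 §4(b)
without any `μ − μ_exc` correction: the exceptional world kills per-dilation and `ℓ¹`-over-dilations forms and
fixed-`η` `o(main)` forms, not the signed, `η`-coupled comparison.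
(B) RELATIVE VS ABSOLUTE.  `Σ₀ ≲ η · 𝔖(φ,ψ) ·` (absolute scale) and cell-completeness from finitely many
`Λ_(k)`-laws both lose the factor `sup_{‖(φ,ψ)‖_N ≤ L} 𝔖(φ,ψ) ≍ log log N` (discriminant-rich pairs), so at
fixed sieve parameters the engine delivers the RELATIVE laws (yardstick `ε(1 + 𝔖)·scale`, Green–Tao Conj. 1.4
shape) — the same budget discovery as the sibling lines `one-level-per-epsilon` / `section-annihilator`.  Hence
`VectorLambdaLawTwoRel`, `CellParityLawRelAt` (verbatim the sibling's yardstick) and the declared residual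
`stub_absoluteCellsTwo` (content: the same dissection with `log z ≍ ε log N / log log N` and completeness
uniform in the rank — a quantitative re-run, filed, not claimed).
(C) `Σ₂V` is written with the tree's `truncUpperV`, so `switchedResidual = Σ₂V(cond) − ρ Σ₂V(unc)` on the nose
(prover glue: push the lattice sum forward to a `SieveSequence` on the values of `φ`).

`CellParityLaw_of` composes the seven stubs into the crux BY NAME (kernel-checked, no `sorry`): `t = 0` vacuous,
`t = 1` stub 1, `t = 2` stubs 2–6, `t ≥ 3` by `Nat.le_induction` on stub 7, `cellParityLaw_iff_forall_at`.

## Disproof used (cdisprove `Disproof.lean` 2026-08-15T22:41Z, rc 0; evidence store not mounted in this jail —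
read through the item notes, as for gen-1 and all three triagers): `cellParityLaw_false_without_twoLeU/convex/
box/size/pairwise` — every statement below keeps `2 ≤ u`, convex `K ⊆ realBox`, `affLinSize ≤ L`,
`IsNondegenerateSystem` of the PAIR; `modelCell_top_eq_zero` (`A_u(N) = 0`): the atom and the vector law carry the
factor `modelCell N u jc / N`, so at `jc = u` they assert smallness — consistent, the true top cells are one
`log` inside the budget at value scale `(L+1)N`; `cellParityLaw_false_logSucc`: all budgets are exactly
`ε · (1+𝔖) · N (log N)^{main exponent}`, never a log better.  Negatives index (3): rough cells + BV only (no
`ConvMomentLevelOne` small-prime bias); no degenerate Chowla window (`RectangleChowla`: here `d ≥ N^{1/2-δ}` and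
`e ≥ N^η` both `→ ∞`); no Elliott-type structure hypothesis (`TupleElliott`).
-/

namespace Summit.Parity.GeneralizedHardyLittlewood.Cruxes.CellParityLaw.SignedSwitchingMoebiusResidual

open scoped BigOperators
open Finset Literature.NumberTheory.Sieve Literature.NumberTheory.Sieve.BombieriSieve
open Classical

noncomputable section

/-! ### Cells, the fixed-`t` crux (absolute and relative), and the `t`-splitting (pure logic, proved) -/

/-- Rough `Ω`-cell at a real roughness threshold `w`: `P⁻(m) > w` and `Ω(m) = j`
(Mathlib: `Nat.minFac`, `ArithmeticFunction.cardFactors`). -/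
def roughCellAt (w : ℝ) (j m : ℕ) : Prop :=
  w < (Nat.minFac m : ℝ) ∧ ArithmeticFunction.cardFactors m = j

/-- The crux's cell predicate: threshold `N^{1/u}`. -/
def roughCell (N u j m : ℕ) : Prop :=
  roughCellAt ((N : ℝ) ^ ((1 : ℝ) / u)) j m

/-- The model cell `A_j(N) = #{m ≤ N : P⁻(m) > N^{1/u}, Ω(m) = j}` of the crux. -/
def modelCell (N u j : ℕ) : ℕ :=
  ((Icc 1 N).filter fun m => roughCell N u j m).card

/-- The crux at a FIXED number of forms `t` (verbatim body of `LeeYangFibres.CellParityLaw` with the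
leading `∀ t` removed; ABSOLUTE yardstick `ε N / log^t N`). -/
def CellParityLawAt (t : ℕ) : Prop :=
  ∀ (L u : ℕ), 1 ≤ t → 2 ≤ u → ∀ ε : ℝ, 0 < ε → ∃ N₀ : ℕ, ∀ N : ℕ, N₀ ≤ N → ∀ Ψ : Fin t → Literature.NumberTheory.Sieve.AffLinForm 1, Literature.NumberTheory.Sieve.IsNondegenerateSystem Ψ → Literature.NumberTheory.Sieve.affLinSize Ψ N ≤ L → ∀ K : Set (Fin 1 → ℝ), Convex ℝ K → K ⊆ Literature.NumberTheory.Sieve.realBox 1 N → ∃ θ : Finset (Fin t) → ℝ, θ ∅ = 1 ∧ (∀ S, |θ S| ≤ 2) ∧ ∀ j : Fin t → ℕ, (∀ i, 1 ≤ j i ∧ j i ≤ u) → |((((Literature.NumberTheory.Sieve.latticeBox 1 N).filter (fun n => Literature.NumberTheory.Sieve.realPoint n ∈ K ∧ ∀ i, (N : ℝ) ^ ((1 : ℝ) / u) < (Nat.minFac ((Ψ i).eval n).toNat : ℝ) ∧ ArithmeticFunction.cardFactors ((Ψ i).eval n).toNat = j i)).card : ℕ) : ℝ) - (∑ S : Finset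 (Fin t), θ S * ∏ i ∈ S, (-1 : ℝ) ^ (j i + 1)) * (Literature.NumberTheory.Sieve.archFactor Ψ K * Literature.NumberTheory.Sieve.singularProduct Ψ * ∏ i, ((((Finset.Icc 1 N).filter (fun m => (N : ℝ) ^ ((1 : ℝ) / u) < (Nat.minFac m : ℝ) ∧ ArithmeticFunction.cardFactors m = j i)).card : ℕ) : ℝ) / N)| ≤ ε * N / Real.log N ^ t

/-- The RELATIVE cell parity law at `t` forms: the same statement with the relative-plus-absolute
yardstick `ε (1 + ∏_p β_p(Ψ)) N / log^t N` (verbatim the yardstick of the sibling line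
`one-level-per-epsilon`'s `CellParityLawRelAt`; equal to the absolute law on systems of bounded singular
product, weaker exactly on the discriminant-rich systems with `∏_p β_p ≍ (log log N)^{t-1}`). -/
def CellParityLawRelAt (t : ℕ) : Prop :=
  ∀ (L u : ℕ), 1 ≤ t → 2 ≤ u → ∀ ε : ℝ, 0 < ε → ∃ N₀ : ℕ, ∀ N : ℕ, N₀ ≤ N → ∀ Ψ : Fin t → Literature.NumberTheory.Sieve.AffLinForm 1, Literature.NumberTheory.Sieve.IsNondegenerateSystem Ψ → Literature.NumberTheory.Sieve.affLinSize Ψ N ≤ L → ∀ K : Set (Fin 1 → ℝ), Convex ℝ K → K ⊆ Literature.NumberTheory.Sieve.realBox 1 N → ∃ θ : Finset (Fin t) → ℝ, θ ∅ = 1 ∧ (∀ S, |θ S| ≤ 2) ∧ ∀ j : Fin t → ℕ, (∀ i, 1 ≤ j i ∧ j i ≤ u) → |((((Literature.NumberTheory.Sieve.latticeBox 1 N).filter (fun n => Literature.NumberTheory.Sieve.realPoint n ∈ K ∧ ∀ i, (N : ℝ) ^ ((1 : ℝ) / u) < (Nat.minFac ((Ψ i).eval n).toNat : ℝ) ∧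 ArithmeticFunction.cardFactors ((Ψ i).eval n).toNat = j i)).card : ℕ) : ℝ) - (∑ S : Finset (Fin t), θ S * ∏ i ∈ S, (-1 : ℝ) ^ (j i + 1)) * (Literature.NumberTheory.Sieve.archFactor Ψ K * Literature.NumberTheory.Sieve.singularProduct Ψ * ∏ i, ((((Finset.Icc 1 N).filter (fun m => (N : ℝ) ^ ((1 : ℝ) / u) < (Nat.minFac m : ℝ) ∧ ArithmeticFunction.cardFactors m = j i)).card : ℕ) : ℝ) / N)| ≤ ε * (1 + Literature.NumberTheory.Sieve.singularProduct Ψ) * N / Real.log N ^ t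

/-- The crux is the conjunction of its fixed-`t` cases (pure logic). -/
theorem cellParityLaw_iff_forall_at :
    Summit.Parity.GeneralizedHardyLittlewood.Theses.LeeYangFibres.CellParityLaw ↔
      ∀ t : ℕ, CellParityLawAt t := by
  constructor
  · intro h t L u ht hu ε hε
    exact h t L u ht hu ε hε
  · intro h t L u ht hu ε hε
    exact h t L u ht hu ε hε

/-- `t = 0` is vacuous (`1 ≤ 0` is false). -/
theorem cellParityLawAt_zero : CellParityLawAt 0 := by
  intro L u ht
  exact absurd ht (by norm_num)

/-! ### Objects of the line (pairs of forms `(φ, ψ)`: `φ` sieved, `ψ` conditioning) -/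

/-- The single-form-conditioned set `{n ∈ [-N,N] ∩ K : ψ(n) ∈ Cell_jc}` (for `ψ(n) ≤ 0`, `toNat = 0` is in
no cell once `N ≥ 2^u`). -/
def condSet (ψ : AffLinForm 1) (K : Set (Fin 1 → ℝ)) (N u jc : ℕ) : Finset (Fin 1 → ℤ) :=
  (latticeBox 1 N).filter fun n => realPoint n ∈ K ∧ roughCell N u jc (ψ.eval n).toNat

/-- The comparison ratio `ρ = 𝔖(φ,ψ) · (A_jc(N)/N) / 𝔖(φ)`: the density of the conditioning cell as seen by
`z`-rough / `Λ`-type weights on the sieved form (`𝔖(φ) = a/φ(a)` for `φ = a n + b`, `(a,b) = 1`; Lean's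
`x / 0 = 0` only in the degenerate case `(a,b) > 1`, where every pre-sieved sum below is empty for large `N`).
Checked prime by prime (gen-1 line card): `p ∤ a_φ a_ψ D`: `(p−2)p/(p−1)² = β_p(φ,ψ)/(β_p(φ)β_p(ψ))`; `p ∣ D`,
`p ∣ a_ψ`, `p ∣ a_φ`: consistent. -/
def condRatio (φ ψ : AffLinForm 1) (N u jc : ℕ) : ℝ :=
  singularProduct ![φ, ψ] * ((modelCell N u jc : ℝ) / N) / singularProduct ![φ]

/-- THE SIGNED SWITCHED RESIDUAL of the pair `(φ, ψ)` at level `y = N^{1/2-δ}`, pre-sieve `z = N^η`, weight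
vector `a ∷ k'`: `∑_{n ∈ K ∩ [-N,N], φ(n) > 0, ψ(n) > 0, (φ(n), P(z)) = 1} (1_{Cell_jc}(ψ(n)) − ρ) ·
truncUpperV k' a y (φ(n))`, where the tree's `truncUpperV k' a y m = ∑_{de = m, d ≥ y} 𝔏_(k')(d)(log e)^a` is
the beyond-level-`y` part of `Λ_(a∷k')(m)`.  This is EXACTLY `Σ₂V(conditioned) − ρ · Σ₂V(unconditioned)` of the
two Friedlander–Iwaniec dissections (tree `sigma2V`, after pushing the lattice sum forward to the value sequence
of `φ`); in switched form `∑_{e z-rough} (log e)^a ∑_{d ≥ y} 𝔏_(k')(d) · b(n(ed))` with the BALANCED indicator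
`b = 1_{Cell_jc} ∘ ψ − ρ` along the dilated copies `φ/e`, dilations `e ∈ {1} ∪ [N^η, (L+1)N^{1/2+δ}]`
(`e = 1` has weight `(log 1)^a = 0`). -/
def switchedResidual (φ ψ : AffLinForm 1) (K : Set (Fin 1 → ℝ)) (N u jc : ℕ) (ks' : List ℕ) (a : ℕ)
    (δ η : ℝ) : ℝ :=
  ∑ n ∈ (latticeBox 1 N).filter (fun n => realPoint n ∈ K ∧ 0 < φ.eval n ∧ 0 < ψ.eval n ∧
      Nat.Coprime (φ.eval n).toNat (primesProdBelow ((N : ℝ) ^ η))),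
    ((if roughCell N u jc (ψ.eval n).toNat then (1 : ℝ) else 0) - condRatio φ ψ N u jc) *
      truncUpperV ks' a ((N : ℝ) ^ ((1 : ℝ) / 2 - δ)) (φ.eval n).toNat

/-! ### The seven stub STATEMENTS (named `Prop`s) -/

/-- STUB 1 statement: the crux for ONE form (`t = 1`): Landau–Alladi cells of one progression segment
against the model `archFactor · (a/φ(a)) · A_j(N)/N` (parity-affine with any amplitude; the truth is amplitude
`0`).  Absolute = relative here (`𝔖(ψ) = a/φ(a)` is bounded in terms of `L`). -/
def SingleFormCells : Prop := CellParityLawAt 1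

/-- STUB 2 statement (Type I, PROVABLE NOW): **Bombieri–Vinogradov for rough `Ω`-cells.** For the value sequence
`γ(m) = 1[P⁻(m) > w, Ω(m) = j, X₁ < m]` (`w ≥ X^{1/u₀}`; `j` and the lower cut `X₁` arbitrary),
`∑_{q ≤ X^{1/2-δ}} max_{(r,q)=1} |Δ(γ; X, q, r)| ≤ X (log X)^{-A}` with Polymath's discrepancy `apDiscrepancy`
(class count minus the coprime average over `φ(q)`), eventually in `X`.  How the reduction consumes it (triage
F1 made harmless): a divisibility `m₀ ∣ φ(n)` with `(m₀, a_φ) = 1` is ONE class `n ≡ r₀ (mod m₀)`, i.e. ONE class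
of the conditioning values `ψ(n) = a_ψ n + b_ψ` modulo `|a_ψ| m₀ ≤ L N^{1/2-δ/2}` — a plain class count of `γ` at
value scale `X = (L+1)N`, threshold `w = N^{1/u} ≥ X^{1/(u+1)}`; unit classes directly, the boundedly many
non-unit classes (primes `p ∣ D = a_ψ b_φ − a_φ b_ψ`, `N^{1/u} < p ≤ N^{1/2}`) after peeling `p`.  This is
Motohashi's theorem (GEH[θ < 1/2], Polymath 8b Thm 2.7(iii); tree docstring of `GeneralizedElliottHalberstam`):
Siegel–Walfisz for the primes `> w ≥ X^{1/u₀}` in each factor + the bilinear large sieve (tree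
`BombieriFriedlanderIwaniecTheorem0b_holds`; `bombieri_vinogradov_holds` for `j = 1`). -/
def BVRoughCells : Prop :=
  ∀ u₀ : ℕ, 2 ≤ u₀ → ∀ δ : ℝ, 0 < δ → ∀ A : ℝ, 0 < A →
    ∃ X₀ : ℕ, ∀ X : ℕ, X₀ ≤ X → ∀ w : ℝ, (X : ℝ) ^ ((1 : ℝ) / u₀) ≤ w → ∀ (j X₁ : ℕ),
      ∑ q ∈ Icc 1 ⌊(X : ℝ) ^ ((1 : ℝ) / 2 - δ)⌋₊,
        ⨆ r : (ZMod q)ˣ,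
          |apDiscrepancy (fun m => if roughCellAt w j m ∧ X₁ < m then (1 : ℝ) else 0) X q
              (r : ZMod q)|
        ≤ (X : ℝ) / Real.log X ^ A

/-- STUB 3 statement (the ATOM, open): **the signed switched residual is small, with accuracy coupled to the
pre-sieve.**  For every pair size `L`, roughness `u ≥ 2`, weight vector `a ∷ k'` with front exponent `a ≥ 2`,
level defect `δ ∈ (0, 1/4)` and `ε > 0` THERE IS `η₀ > 0` such that for EVERY pre-sieve exponent
`η ∈ (0, η₀]`, eventually in `N`, uniformly over non-degenerate pairs `(φ, ψ)` of size `≤ L`, convex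
`K ⊆ [-N,N]` and cells `jc ∈ [1,u]`:
`|switchedResidual| ≤ ε (1 + 𝔖(φ,ψ)) N (log N)^{|k'|+a-2}` (the main-term scale of the conditioned
`Λ_(a∷k')` statistic is `≍ 𝔖(φ,ψ) N (log N)^{|k'|+a-2}`; the trivial bound is `(log N)^{2+}` larger).  The
quantifier order `∀ε ∃η₀ ∀η ≤ η₀` is LOAD-BEARING (gen-2 correction (A)): at fixed `η` the residual carries the
mirror image `≍ η^{a-1} ·` main of `Σ₀`'s parity content in the pair-ghost / resonant-Siegel worlds. -/
def SignedResidual : Prop :=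
  ∀ (L u : ℕ), 2 ≤ u → ∀ (ks' : List ℕ) (a : ℕ), 2 ≤ a →
    ∀ δ : ℝ, 0 < δ → δ < 1 / 4 → ∀ ε : ℝ, 0 < ε →
      ∃ η₀ : ℝ, 0 < η₀ ∧ ∀ η : ℝ, 0 < η → η ≤ η₀ →
        ∃ N₀ : ℕ, ∀ N : ℕ, N₀ ≤ N →
          ∀ φ ψ : AffLinForm 1, IsNondegenerateSystem ![φ, ψ] → affLinSize ![φ, ψ] N ≤ L →
            ∀ K : Set (Fin 1 → ℝ), Convex ℝ K → K ⊆ realBox 1 N → ∀ jc : ℕ, 1 ≤ jc → jc ≤ u →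
              |switchedResidual φ ψ K N u jc ks' a δ η| ≤
                ε * (1 + singularProduct ![φ, ψ]) * N * Real.log N ^ (ks'.sum + a - 2)

/-- STUB 4/5 interface — the card's Transfer `C⁺` at `t = 2`, RELATIVE form: **vector `Λ`-laws for one form
over a single-form rough cell.**  For every vector `(k)` with `max k_ν ≥ 2`:
`∑_{n ∈ K : ψ(n) ∈ Cell_jc} Λ_(k)(φ(n)) = γ_(k) · archFactor(φ,ψ;K) · 𝔖(φ,ψ) · (A_jc(N)/N) · (log N)^{|k|-1}
± ε (1 + 𝔖(φ,ψ)) N (log N)^{|k|-2}` uniformly (`γ_(k) = ∏ kᵢ!/(|k|-1)!`, tree `gammaV`; `Λ_(k)` = tree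
`lambdaVec`; `Λ(φ(n)) = 0` for `φ(n) ≤ 0` via `toNat`).  Parity-even: it holds in the Liouville pair-ghost and
exceptional-character worlds as well as in the Hardy–Littlewood world (Bombieri's theorem: `Λ_(k)` statistics
with `max k_ν ≥ 2` do not see the parity of the sifted variable). -/
def VectorLambdaLawTwoRel : Prop :=
  ∀ (L u : ℕ), 2 ≤ u → ∀ ks : List ℕ, (∃ k ∈ ks, 2 ≤ k) → ∀ ε : ℝ, 0 < ε →
    ∃ N₀ : ℕ, ∀ N : ℕ, N₀ ≤ N →
      ∀ φ ψ : AffLinForm 1, IsNondegenerateSystem ![φ, ψ] → affLinSize ![φ, ψ] N ≤ L →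
        ∀ K : Set (Fin 1 → ℝ), Convex ℝ K → K ⊆ realBox 1 N → ∀ jc : ℕ, 1 ≤ jc → jc ≤ u →
          |(∑ n ∈ condSet ψ K N u jc, lambdaVec ks (φ.eval n).toNat) -
              gammaV ks * (archFactor ![φ, ψ] K * singularProduct ![φ, ψ] *
                ((modelCell N u jc : ℝ) / N)) * Real.log N ^ (ks.sum - 1)|
            ≤ ε * (1 + singularProduct ![φ, ψ]) * N * Real.log N ^ (ks.sum - 1) / Real.log N

/-- STUB 4 statement (the REDUCTION, XL but by the book): Type I for single-form cells + the signed residual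
⟹ the relative `t = 2` vector laws. -/
def VectorLawTwo : Prop :=
  BVRoughCells → SignedResidual → VectorLambdaLawTwoRel

/-- STUB 5 statement (Bombieri COMPLETENESS + Walsh assembly at `t = 2`, provable, L/XL): the relative vector laws
for both conditionings of a pair and the single-form law give the relative `t = 2` law. -/
def CompletenessTwo : Prop :=
  VectorLambdaLawTwoRel → CellParityLawAt 1 → CellParityLawRelAt 2

/-- STUB 6 statement (DECLARED RESIDUAL at `t = 2`, not addressed by the lever at fixed sieve parameters):
relative ⇒ absolute cells for pairs, i.e. the `(log log N)`-uniformity of the law on discriminant-rich pairs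
(`𝔖(φ,ψ) ≍ D/φ(D)`, `D = a_ψ b_φ − a_φ b_ψ`).  Cell-level twin at `t = 2` of the route item `AbsoluteUpgrade`
and of the sibling lines' `stub_absoluteCells`; moot if the route consumes the relative law. -/
def AbsoluteCellsTwo : Prop :=
  CellParityLawRelAt 2 → CellParityLawAt 2

/-- STUB 7 statement (the honest `t ≥ 3` rung, OPEN, hardest, not attacked by this line): the induction step in
the number of forms. -/
def HigherRung : Prop :=
  ∀ t : ℕ, 2 ≤ t → CellParityLawAt t → CellParityLawAt (t + 1)

/-! ### The registered stubs -/

/-- STUB 1 (L, provable now) — `CellParityLawAt 1`: for `ψ = a n + b` (`|a| + |b|/N ≤ L`) and an interval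
`K ⊆ [-N,N]`, `C_j = #{n ∈ K : P⁻(ψ(n)) > N^{1/u}, Ω(ψ(n)) = j}` equals
`(1 + θ₁σ_j) · |K ∩ {ψ > 0}| · (a/φ(a)) · A_j(N)/N ± εN/log N` for SOME `|θ₁| ≤ 2` (take `θ₁ = 0`).
Proof route: bodies of length `≤ c(ε,u,L) N` by the upper-bound sieve (`#{rough values in an interval of
length Y} ≪ uY/log N`: both the count and the model are below the absolute budget), longer bodies by PNT in
APs with relative error `o(1)` for the fixed modulus `a ≤ L` on intervals of relative length `≥ c`
(tree `bombieri_vinogradov_holds` ⊇ fixed modulus; `primeCounting_isEquivalent_holds`) and Buchstab induction on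
`j` (tree `RoughNumbersBuchstab*.lean`): the same Buchstab integrals on both sides, profile continuity absorbs
the value scale `≤ (L+1)N` vs the model scale `N`; top cells `j = u` (`A_u(N) = 0`, `modelCell_top_eq_zero`)
hold `≍ N/(log N)^u = o(N/log N)` values.  NO short-interval PNT is needed (answer to the Disproof index
remark: short bodies are inside the absolute budget by Brun–Titchmarsh).  Honours `_false_without_twoLeU`
(`u ≥ 2`), `_false_logSucc` (budget `εN/log N` exactly).  Leans on: Alladi1982 (Ω-refined Buchstab asymptotics,
source wanted acq-03831), Tenenbaum2015 III.6, route item `LeeYangFibres.ModelCellFacts` (stmt-Parity-14111). -/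
theorem stub_singleFormCells : SingleFormCells := by
  sorry

/-- STUB 2 (L/XL, provable now) — Bombieri–Vinogradov for rough `Ω`-cells, verbatim `BVRoughCells`.  Why true:
`1_{P⁻>w, Ω=j}` on `(X₁, X]`, `w ≥ X^{1/u₀}`, is supported on `j`-fold products of primes `> X^{1/u₀}`; `j = 1`
is BV for primes (difference of two heights); for `j ≥ 2` every such `m` factors as `p · m'` with
`X^{1/u₀} < p ≤ X^{1/2}` and `m' ≥ X^{1/u₀}`, so the Vaughan-free bilinear large sieve with Siegel–Walfisz in
one variable applies (Motohashi 1976; BombieriFriedlanderIwaniecActa1986 Thm 0; tree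
`BombieriFriedlanderIwaniecTheorem0b_holds`, `SiegelWalfiszMoebius_holds`, pattern
`RoughNumbersInProgressions.lean`); coincidences (`m = p²m''`) are `≪ X^{1-1/u₀}`; the constant `C(A)` is
absorbed by `A + 1`.  Degenerate checks: `q = 1` term is `0`; `w > X` or `j = 0` give `γ = 0` on `m > 1`.
Siegel-consistent (ℓ¹ over moduli; ideator-3 note §4(a)).  Why it might need reshaping: only the
sup-over-units / `apDiscrepancy` packaging (same as the tree's `GeneralizedElliottHalberstam`). -/
theorem stub_bvRoughCells : BVRoughCells := by
  sorry

/-- STUB 3 (the ATOM; OPEN, Hardy–Littlewood-class technology, PARITY-BLIND content; the line's load-bearing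
input) — verbatim `SignedResidual`.
* Heuristic truth (HL world): conditionally on `n mod p`, `p < z`, the balanced weight
  `1_{Cell}(ψ(n)) − ρ_z` is uncorrelated with the `𝔏_(k')`/log-weighted factorisations `φ(n) = d·e`; primes
  `p ≥ z` contribute relative corrections `O(∑_{p≥z} p^{-2} + #{p ∣ D, p ≥ z}/z) → 0`, `ρ_z → ρ`.  The
  `O(1/log N)` local distortions at small primes `p ∣ φ(n)` (`(p−1)/(p−2)` for `p ∤ D`, `0` for `p ∣ D`) live in
  `Σ₀` (`p < z`), OUTSIDE the atom; inside it only `p ≥ z` occur (relative `O(1/(ηz))`).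
* NO OVERSHOOT (gen-2): given `BVRoughCells` and the `t = 1` facts, `VectorLambdaLawTwoRel` implies the atom
  back with `|switchedResidual| ≤ C(ε + η + e^{-δ/2η} + o(1))(1+𝔖)N(log N)^{|k'|+a-2}` (dissection identity
  `Σ₂ = S − Σ₀ − Σ₁` for both sequences; `Σ₀ ≪ η·`main is where the coupling `η ≤ η₀(ε)` comes from).  Hence the
  atom holds in every world where the parity-even `Λ_(k)`-laws and BV hold: the Liouville pair-ghost world
  `w = 1 + λ(φ)λ(ψ)` (`SelbergParityBarrier`, `PrimePairParity`, `SignGhost`) and the exceptional-character world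
  for resonant pairs `(n, n+q₁)` (ideator-3 §3–4: there the per-dilation sums `∑_d μ(d) b(n(ed))` have NO
  cancellation — `μ(d) = ±μ²(d)χ̄(e)` on the support — and the smallness comes from the signed sum over the
  `z`-rough dilations `e`, `∑_e χ̄(e)(log e)^a/e`-type, which is `≍ η^{a-1}` relative, → 0 with `η`).  At FIXED
  `η` the residual is `≈ (−1)^{jc}ρ x V(z)(log z)^a ∫₁^s v^aℓ(v)dv ≍ η^{a-1}|c_a((1/2+δ)/η)|·`main in those
  worlds (`c_a(∞) = ∫v^aℓ`: `−2e^γ` for `a = 2`; kit j008753 PART A: `≈ 0.10–0.14 ×` main at `a = 2`): a fixed-`η` `o(main)` typing (gen-1) or any `ℓ¹`-over-dilations typing (the card's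
  `DilatedMoebiusCellsMid`; sibling card `composite-fibres-first`'s `DilatedFibreMoebius`) is parity- and
  Siegel-sensitive — this typing is not.
* Numerics: kit j006558 (ideator) / triage r1-3 replication (`∑|S(e)|/∑√T(e) ∈ [0.57,1.25]` per dyadic block,
  `N = 10⁶–10⁸`): square-root cancellation along dilations in the REAL world; kit j007855 (gen-1,
  `mid_residual_check.py`, `N = 10⁷`, `η = 0.24`, incl. the vector weight `𝔏_(2) = μ∗Λ₂`): `S_c/(ρ_z S_u) =
  1 ± 0.025` on bulk cells; kit j008753 (gen-2, `compute/eta_scan_residual.py`, `φ = n`, `ψ = n + h`,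
  `h ∈ {2, 30030}` (`𝔖 = 1.32, 5.12`), `N = 10⁷`, `u = 4`, `δ = 0.1`, `η ∈ {0.30, 0.24, 0.18, 0.12}`, scalar
  weights `a ∈ {2,3}`): PART B (reality) `R/main = +0.002, −0.002, −0.013` (`jc = 1,2,3`, `a = 2`, `h = 2`,
  `η = 0.30`) and `+0.002, −0.001, −0.013` for `h = 30030`, `|R|/main ≤ 3·10⁻³` on the bulk cells at every `η`
  with `z = N^η` above the primes of `h` (at `η = 0.12`, `z = 6.9 < 13`, the primes `7, 11, 13 ∣ 30030` sit
  inside the sifted range and `R/main ≈ −0.035`, a finite-`N` local effect that migrates to `Σ₀` once `z > 13`),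
  `a = 3`: `|R|/main ≤ 10⁻³` on bulk cells; normalisation `∑_{ψ∈Cell₁}Λ₂(φ)/(ρ∑Λ₂(φ)) = 1.007` (`h = 2`) but
  `0.83` for `h = 30030`, the whole defect sitting in the `Σ₀` comparison (`(Σ₀(c) − ρΣ₀(u))/main = −0.15`:
  the `p ∣ D`, `p < z` distortion, `≍ (∑_{p∣D} log p/p)/log N`, relative — correction (B) made visible);
  PART A (the ghost/resonant-Siegel functional, same `N`): `∑_{n rough} λ(n) T_a(n)/(a N (log N)^{a−1}) =
  −0.100, −0.119, −0.137, −0.121` (`a = 2`, `η = 0.30 … 0.12`) and `−0.030, −0.033, −0.034, −0.025` (`a = 3`),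
  matching `∑_e λ(e)(log e)^a V(z)(N/e − y)` to 5 % and the `V(z)(log z)^a c_a(s)` law to 20 % (`c_a(s)`
  saturates at `−2e^γ`, `−8.0` only for `s = 0.6/η ≳ 4`, so the decay in `η` starts below `η ≈ 0.15`): the
  fixed-`η` parity defect is `≈ 10–14 %` of the main term, 30–50× the real residual.
* Nearest technology: dispersion / Kloosterman for the `e ∼ N^{1/2±δ}` end (BFI 1986 Thm 9 shape, tree
  `BombieriFriedlanderIwaniecTheorem9`), Matomäki–Radziwiłł in `q`-aspect (route `ShiftedMultiplicationTable`,
  item `RectangleChowla` — same engine; here both variables `→ ∞`), Drappeau–Topacogullari for the Type-I₂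
  corner.  Why it might be false as typed: only through a normalisation slip in `ρ` (local factors at
  `p ∣ a_φ a_ψ D`) — the refuter's first check; the STRUCTURAL claim is the standard randomness heuristic and
  is equivalent (given BV) to Bombieri's asymptotic sieve for the sequences `{φ(n) : ψ(n) ∈ Cell}`. -/
theorem stub_signedResidual : SignedResidual := by
  sorry

/-- STUB 4 (XL, provable in principle — the tree formalises the level-1 per-sequence version: `BombieriSieve.coreV`,
`lemma11V`, `lemma12V`, `lemma3V`, `vector_cons`) — `BVRoughCells → SignedResidual → VectorLambdaLawTwoRel`.
Given `(L, u, ks, ε)`: (o) permute an exponent `a ≥ 2` to the front (`List.perm_cons_erase`, as in `lemma3V`),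
fix `δ = 1/8`; take `η₀` from the atom at `ε/4`, then `η = min(η₀, ε/(8C), δ/2)` (so `Σ₀ ≤ (ε/8)·`scale and
`s = δ/(2η) ≥ log(8C'/ε)`), then `N₀`.  (i) Dissect `∑_{n ∈ condSet} Λ_(a∷k')(φ(n))` and the unconditioned
`∑_{n ∈ K, φ,ψ > 0} Λ_(a∷k')(φ(n))` with `y = N^{1/2-δ}`, `z = N^η` (`sum_eq_sigma0V_add_sigma1V_add_sigma2V` on
the push-forward `SieveSequence`s `m ↦ #{n : φ(n) = m, …}` — the family-uniform re-cut triage F2/X4 asks for);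
(ii) `Σ₀ ≤ Cη(1+𝔖)N(log N)^{|k|-2}` for both (upper-bound sieve, `sigma0V_le_sigma0` + `FI1978_lemma10`-shape,
uniform in the pair); (iii) `Σ₁V(cond) − ρ Σ₁V(unc) = O((e^{-s} + (log N)^{-A})(1+𝔖)N(log N)^{|k|-2})` by the
fundamental lemma (`fundamental_lemma_uniform_holds`) fed with `BVRoughCells` at moduli `m₀ = dν ≤ N^{1/2-δ/2}`
(`m₀ ∣ φ(n)`, `(m₀, a_φ) = 1`, is one class of `n mod m₀`, i.e. one class of the values `ψ(n)` mod `|a_ψ| m₀`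
at value scale `X = (L+1)N`; unit classes directly, the `≤ u` non-unit ones — primes `p ∣ D` in
`(N^{1/u}, N^{1/2}]` — after peeling `p`; densities `g_c(p) = 1/(p-1)`, `0`, `1/p` according as `p ∤ a_φ a_ψ D`,
`p ∣ D`, `p ∣ a_ψ`) and the IDENTITY `V_c(z) A_c = ρ_z V_u(z) A_u`, `ρ_z = 𝔖(ψ)(A_jc/N) ∏_{p<z}
β_p(φ,ψ)/(β_p(φ)β_p(ψ)) → ρ` (Euler products of `localFactor`, `tendsto_singularProductPartial`);
(iv) `Σ₂V(cond) − ρ Σ₂V(unc) = switchedResidual` on the nose (`e` is `z`-rough: `e = 1` has weight `0`), bounded by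
the atom at the chosen `η`; (v) the unconditioned total `= γ_(k) (a_φ/φ(a_φ)) |K ∩ {φ,ψ>0}| (log N)^{|k|-1}(1+o(1))`
by `lemma3V` in progressions of modulus `a_φ ≤ L` (Siegel–Walfisz level; `𝔖(φ) = a_φ/φ(a_φ)`), so
`ρ ·`(total) is the model of `VectorLambdaLawTwoRel`.  Output accuracy `(ε/4 + Cη + C'e^{-s} + o(1))(1+𝔖) ≤ ε(1+𝔖)`:
RELATIVE, because (ii) is (gen-2 correction (B)).  Honours `_false_without_size/box/convex` (all used in (iii)). -/
theorem stub_vectorLawTwo : VectorLawTwo := by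
  sorry

/-- STUB 5 (L/XL, provable; pure — no distributional input) — `VectorLambdaLawTwoRel → CellParityLawAt 1 →
CellParityLawRelAt 2`.  (i) FINITARY BOMBIERI COMPLETENESS: for a finite sequence supported on values `≍ N`,
the `Λ_(k)`-laws for all vectors with `|k| ≤ K₀(ε, u)`, `max ≥ 2`, with main terms `γ_(k) · 𝔐 · (log N)^{|k|-1}`
force every PARITY-EVEN cell functional `f` (`∑_j f_j a_j σ_j = 0`, `a_j = A_j(N)/N`, `σ_j = (−1)^{j+1}`) to take
the value `𝔐 · ∑_j f_j a_j ± ε 𝔐'/log N` (Bombieri 1976 / BombieriRIMS1977 Thm p. 5: the `Λ_(k)` determine the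
type distribution on each `P_r` up to `δ` (odd `r`) / `2 − δ` (even `r`); FriedlanderIwaniecPisa1978 §1; made
quantitative by polynomial approximation of the rough-cell indicators on the type simplices plus an upper-bound
sieve for the boundary shells `{p ∣ φ(n), p = N^{1/u ± κ}}` — whose mass is `≍ κ u 𝔖 N/log²N`, which is why the
output is RELATIVE in `𝔖`; `Bombieri1976_P2Distribution` is the only vendored instance); applied to
`condSet ψ · jc` with `𝔐 = arch · 𝔖(φ,ψ) · a_jc N` for BOTH orderings of the pair; (ii) WALSH ASSEMBLY at `t = 2`:
columns `C_{·,j₂} ∈ M a_{j₂} a + ℝ w`, rows likewise (`w = (a_j σ_j)_j`), so `C = M a ⊗ a + θ M w ⊗ w`, i.e.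
`C_{(j₁,j₂)} = M a_{j₁} a_{j₂} (1 + θ₁₂ σ₁ σ₂) ± ε'(1+𝔖)N/log²N` with `|θ₁₂| ≤ 1 + o(1)` by positivity for
`u ≥ 3` and `≤ 2` from `VectorLambdaLawTwoRel` at `k = (2)`, `jc = 1` for `u = 2` (`C₁₁ ≤ (2+o(1))M a₁²`, Bombieri's
EH-bound shape, inside the cap `1 + θ₁₂ ≤ 3`); (iii) `CellParityLawAt 1` supplies `|condSet|`, the comparison
cells and Alladi's parity balance; top cells `j = u` are inside the budget (`modelCell_top_eq_zero`).  Leans on: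
BombieriRIMS1977, BombieriAsymptoticSieve1976, FriedlanderIwaniecPisa1978 (Thm 1, Lemma 1), tree
`lambdaVec_eq_zero_of_lt_card_primeFactors`, `bombieri_asymptotic_sieve_indeterminacy` (sharpness), triage X1
(`walshInversionPositivity`, `Sketch-ideator3.lean`). -/
theorem stub_completenessTwo : CompletenessTwo := by
  sorry

/-- STUB 6 (DECLARED RESIDUAL, open as typed; XL as a quantitative re-run) — `CellParityLawRelAt 2 →
CellParityLawAt 2`.  On pairs with `𝔖(φ,ψ) ≤ S` the relative law at `ε/(1+S)` IS the absolute law; the residual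
is the family `S < 𝔖(φ,ψ) ≤ C_L log log N` (discriminants `D = a_ψ b_φ − a_φ b_ψ ≤ 2L(L+1)N` with many small
prime factors, e.g. primorial shifts).  What would discharge it inside the mechanism: the same dissection with
`log z = c log N / log log N` (`Σ₀ ≲ (log z/log N)·𝔖·`scale becomes absolute; `s = (δ/2c) log log N → ∞`;
the atom at that `z` is still ghost-consistent because the defect `η^{a-1}𝔖` stays `≤ c` for `a = 2` and `→ 0`
for `a ≥ 3`) together with completeness UNIFORM in the rank `|k| ≤ K₀(N) → ∞` (tree pattern
`BombieriAsymptoticSieveRankUniform.lean`).  Filed so that the skeleton concludes the ABSOLUTE crux; the same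
residual is filed by both sibling lines (`stub_absoluteCells`), whose cards recommend consuming the relative law
at route level (`HyperbolicityClipsParity` already works at relative accuracy).  True if the crux is. -/
theorem stub_absoluteCellsTwo : AbsoluteCellsTwo := by
  sorry

/-- STUB 7 (OPEN, HARDEST in absolute terms, not attacked; carried so that the skeleton concludes the crux for all
`t`) — `∀ t ≥ 2, CellParityLawAt t → CellParityLawAt (t+1)`.  What is missing at `t+1 ≥ 3` (gen-1 analysis,
confirming triage X2/F3): the single-cell-conditioned JOINT vector laws (reachable by this engine at PRODUCT level
`∏ d_s ≤ N^{1/2-δ}` from `BVRoughCells`, with a bilinear multi-form residual) fix only the `even ⊗ ⋯ ⊗ even`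
parts of the slices `{ψ_c ∈ Cell_jc}`; the common annihilator of these is `{tensors with ≥ 2 w-slots}`, strictly
larger than the CPL family — the profiles `x_c ⊗ w ⊗ w` stay free, and pinning them needs parity-even laws for one
form over a MULTI-form-conditioned set, whose Type-I input (relative equidistribution of prime-tuple-like sets in
APs) is open at every level, even bounded moduli.  Hardness certificate (card §5, triage F4/X5, ideator-3 §1–2):
already `CellParityLawAt 3` at `u ≥ 3` gives rough prime triples `≤ (8 + o(1)) M` against `32` from BV + 2-dim
Selberg, and `CellParityLawAt 3` at `u = 2` is the uniform bound `15·HL₃`.  A lead should park this stub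
(promotion to a route item "CellParityLaw for `t ≥ 3`" recommended) and build stubs 1–6. -/
theorem stub_higherRung : HigherRung := by
  sorry

/-! ### Name-keyed aliases of the seven statements (hypotheses of the composition must be admissible BY NAME for
the native skeleton audit; same device as gen-1 / `Cruxes/MazurKaneLaw/Lines/fibre-toolkit-lp-wall-map.lean`) -/
namespace Registered

/-- Alias of `SingleFormCells` keyed by the registered stub name. -/
abbrev stub_singleFormCells : Prop := SingleFormCells
/-- Alias of `BVRoughCells` keyed by the registered stub name. -/
abbrev stub_bvRoughCells : Prop := BVRoughCells
/-- Alias of `SignedResidual` keyed by the registered stub name. -/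
abbrev stub_signedResidual : Prop := SignedResidual
/-- Alias of `VectorLawTwo` keyed by the registered stub name. -/
abbrev stub_vectorLawTwo : Prop := VectorLawTwo
/-- Alias of `CompletenessTwo` keyed by the registered stub name. -/
abbrev stub_completenessTwo : Prop := CompletenessTwo
/-- Alias of `AbsoluteCellsTwo` keyed by the registered stub name. -/
abbrev stub_absoluteCellsTwo : Prop := AbsoluteCellsTwo
/-- Alias of `HigherRung` keyed by the registered stub name. -/
abbrev stub_higherRung : Prop := HigherRung

end Registered

/-! ### The composition: the seven stubs imply the crux, by name (no `sorry` of its own) -/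

/-- `CellParityLaw` from the seven stubs (pure logic): `t = 2` is STUB 6 applied to STUB 5 fed with STUB 4 (fed
with STUBS 2, 3) and STUB 1; `t ≥ 3` by induction on STUB 7 from `t = 2`; `t = 1` is STUB 1; `t = 0` is vacuous;
`cellParityLaw_iff_forall_at` reassembles the crux. -/
theorem CellParityLaw_of (h1 : Registered.stub_singleFormCells) (h2 : Registered.stub_bvRoughCells)
    (h3 : Registered.stub_signedResidual) (h4 : Registered.stub_vectorLawTwo)
    (h5 : Registered.stub_completenessTwo) (h6 : Registered.stub_absoluteCellsTwo)
    (h7 : Registered.stub_higherRung) :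
    Summit.Parity.GeneralizedHardyLittlewood.Theses.LeeYangFibres.CellParityLaw := by
  refine cellParityLaw_iff_forall_at.mpr ?_
  have hAt1 : CellParityLawAt 1 := h1
  have hRel2 : CellParityLawRelAt 2 := h5 (h4 h2 h3) hAt1
  have hAt2 : CellParityLawAt 2 := h6 hRel2
  have hge : ∀ t : ℕ, 2 ≤ t → CellParityLawAt t := by
    intro t ht
    induction t, ht using Nat.le_induction with
    | base => exact hAt2
    | succ t ht ih => exact h7 t ht ih
  intro t
  rcases Nat.lt_or_ge t 2 with hlt | hge2
  · interval_cases t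
    · exact cellParityLawAt_zero
    · exact hAt1
  · exact hge t hge2

/-- Wiring check: the registered stubs feed `CellParityLaw_of` as stated. -/
example : Summit.Parity.GeneralizedHardyLittlewood.Theses.LeeYangFibres.CellParityLaw :=
  CellParityLaw_of stub_singleFormCells stub_bvRoughCells stub_signedResidual stub_vectorLawTwo
    stub_completenessTwo stub_absoluteCellsTwo stub_higherRung

/-- Sanity (pure logic): the absolute law at `t` implies the relative one whenever the singular product is
non-negative on the systems concerned — recorded as the trivial direction of STUB 6 (hypothesis form, so that no
fact about `singularProduct` is smuggled in). -/
theorem cellParityLawRelAt_of_at (t : ℕ)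
    (hnn : ∀ Ψ : Fin t → AffLinForm 1, IsNondegenerateSystem Ψ → 0 ≤ singularProduct Ψ)
    (h : CellParityLawAt t) : CellParityLawRelAt t := by
  intro L u ht hu ε hε
  obtain ⟨N₀, hN₀⟩ := h L u ht hu ε hε
  refine ⟨N₀, fun N hN Ψ hΨ hsz K hK hKb => ?_⟩
  obtain ⟨θ, hθ0, hθb, hθ⟩ := hN₀ N hN Ψ hΨ hsz K hK hKb
  refine ⟨θ, hθ0, hθb, fun j hj => le_trans (hθ j hj) ?_⟩
  have hS : 0 ≤ singularProduct Ψ := hnn Ψ hΨ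
  have hN' : (0 : ℝ) ≤ N := by exact_mod_cast Nat.zero_le N
  have hlog : 0 ≤ Real.log N ^ t := by
    rcases Nat.eq_zero_or_pos N with rfl | hNpos
    · simp
    · exact pow_nonneg (Real.log_nonneg (by exact_mod_cast hNpos)) t
  have h1 : ε * N ≤ ε * (1 + singularProduct Ψ) * N := by
    have : ε * N * 1 ≤ ε * N * (1 + singularProduct Ψ) :=
      mul_le_mul_of_nonneg_left (by linarith) (mul_nonneg hε.le hN')
    linarith [this]
  exact div_le_div_of_nonneg_right h1 hlog

end

end Summit.Parity.GeneralizedHardyLittlewood.Cruxes.CellParityLaw.SignedSwitchingMoebiusResidual
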